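import Mathlib.Analysis.Complex.Circle
import Mathlib.Analysis.SpecialFunctions.Complex.Circle
import Mathlib.Topology.Homeomorph.Defs
import Mathlib.Topology.Algebra.ContinuousMonoidHom
import Mathlib.Topology.Connected.Basic
import Mathlib.GroupTheory.Divisible
import HarnessLib

/-!
# Frobenioids II, Lemma 3.2: connected open subsets of the circle

Mochizuki, *The geometry of Frobenioids II*, Kyushu J. Math. **62** (2008) 401–460, §3, Lemma 3.2
"Connected Open Subsets of the Circle" (i)–(xii), author's text pp. 25–27
[cite: MochizukiFrdII2008, Lem 3.2 pp.25-27]. This is the elementary topology of `S¹ ⊆ ℂ^×`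
underlying the archimedean Frobenioids of Example 3.3 (isotropic objects, co-angular morphisms,
slit morphisms, the circle in the units `O^×(A) ≅ S¹`).

**Setting.** `S¹` is Mathlib's `Circle` (a compact commutative topological group);
`φ_n : S¹ → S¹`, `z ↦ zⁿ` (`n ∈ ℤ`) is `CircleOpens.phi n`; `A ⊆ B ⊆ S¹` are nonempty connected
open subsets (`IsConnected` includes nonemptiness, matching the printed "[nonempty] connected");
an `(A, B)`-subset is a connected open `C` with `A ⊆ C ⊆ B` (`CircleOpens.IsSub A B C`);
"`w · A`" is the translate `w • A`; "invariant with respect to complex conjugation" is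
`φ_{-1}(X) = X` (on `S¹` complex conjugation is inversion, Mathlib `Circle.coe_inv_eq_conj`).

**Contents.** Items (i)–(xii) one declaration each: (i) PROVED (`eq_iff_forall_isSub_eq`,
`eq_univ_iff_forall_isSub_eq`); (ii)–(xii) typed as named `Prop` facts quoting print (their
printed proofs use arc length, `π₁(S¹) ≠ 1` and `Aut(ℝ,+)`; discharging them is routine real
analysis left to a prover pass). (xii) "`Refl(S¹) ≅ S¹ ⋊ (ℤ/2ℤ)`" is rendered internally
(`Trans ◁ Refl` of index two, complemented by `⟨φ_{-1}⟩`), see `ItemXII_semidirect`.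
Nothing here is specific to Frobenioids; no statement is strengthened.
-/

namespace Literature.AlgebraicGeometry.Frobenioids

open Set Function Topology
open scoped Pointwise

noncomputable section

namespace CircleOpens

/-- `φ_n : S¹ → S¹`, `z ↦ zⁿ` (`n ∈ ℤ`) (FrdII Lem. 3.2, p. 25). [cite: MochizukiFrdII2008, Lem 3.2 p.25] -/
def phi (n : ℤ) : Circle → Circle := fun z => z ^ n

/-- `φ_n` is a group homomorphism (the circle is commutative). [cite: MochizukiFrdII2008, Lem 3.2 p.25] -/
theorem phi_mul (n : ℤ) (z w : Circle) : phi n (z * w) = phi n z * phi n w := mul_zpow z w n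

/-- `φ_{-1}` is inversion, i.e. complex conjugation on `S¹ ⊆ ℂ`. [cite: MochizukiFrdII2008, Lem 3.2 (ii) p.25] -/
theorem phi_neg_one (z : Circle) : phi (-1) z = z⁻¹ := zpow_neg_one z

/-- The standing hypotheses of Lemma 3.2 on a pair `A ⊆ B ⊆ S¹`: both are [nonempty] connected open
subsets (FrdII Lem. 3.2, p. 25). [cite: MochizukiFrdII2008, Lem 3.2 p.25] -/
structure Setting (A B : Set Circle) : Prop where
  /-- `A` is nonempty and connected -/
  isConnected_left : IsConnected A
  /-- `A` is open -/
  isOpen_left : IsOpen A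
  /-- `B` is nonempty and connected -/
  isConnected_right : IsConnected B
  /-- `B` is open -/
  isOpen_right : IsOpen B
  /-- `A ⊆ B` -/
  subset : A ⊆ B

/-- An `(A, B)`-subset: "a connected open subset `C ⊆ B` that contains `A`" (FrdII Lem. 3.2, p. 25).
[cite: MochizukiFrdII2008, Lem 3.2 p.25] -/
def IsSub (A B C : Set Circle) : Prop := IsConnected C ∧ IsOpen C ∧ A ⊆ C ∧ C ⊆ B

/-- `A` itself is an `(A, B)`-subset. [cite: MochizukiFrdII2008, Lem 3.2 p.25] -/
theorem isSub_left {A B : Set Circle} (h : Setting A B) : IsSub A B A :=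
  ⟨h.isConnected_left, h.isOpen_left, subset_rfl, h.subset⟩

/-- `B` itself is an `(A, B)`-subset. [cite: MochizukiFrdII2008, Lem 3.2 p.25] -/
theorem isSub_right {A B : Set Circle} (h : Setting A B) : IsSub A B B :=
  ⟨h.isConnected_right, h.isOpen_right, h.subset, subset_rfl⟩

/-- The whole circle is a nonempty connected open subset, so `(A, S¹)` is a `Setting` whenever `A`
is connected open. [cite: MochizukiFrdII2008, Lem 3.2 p.25] -/
theorem setting_univ {A : Set Circle} (hA : IsConnected A) (hA' : IsOpen A) : Setting A univ :=
  ⟨hA, hA', isConnected_univ, isOpen_univ, subset_univ A⟩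

/-- **Lemma 3.2 (i)** (FrdII p. 25): "`A = B` if and only if every `(A, B)`-subset `C` is, in fact,
equal to `A`." [cite: MochizukiFrdII2008, Lem 3.2 (i) p.25] -/
theorem eq_iff_forall_isSub_eq {A B : Set Circle} (h : Setting A B) :
    A = B ↔ ∀ C, IsSub A B C → C = A := by
  constructor
  · rintro rfl C hC
    exact le_antisymm hC.2.2.2 hC.2.2.1
  · intro H
    exact (H B (isSub_right h)).symm

/-- **Lemma 3.2 (i)**, in particular (FrdII p. 25): "`A = S¹` if and only if every `(A, S¹)`-subset
`C` is, in fact, equal to `A`." [cite: MochizukiFrdII2008, Lem 3.2 (i) p.25] -/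
theorem eq_univ_iff_forall_isSub_eq {A : Set Circle} (hA : IsConnected A) (hA' : IsOpen A) :
    A = univ ↔ ∀ C, IsSub A univ C → C = A :=
  eq_iff_forall_isSub_eq (setting_univ hA hA')

/-- **Lemma 3.2 (ii)**, first sentence (FrdII p. 25): "There exists a `w ∈ S¹` such that the
translated open subset `w · A` satisfies `φ_{-1}(w · A) = w · A` [i.e., `w · A` is invariant with
respect to complex conjugation]." [cite: MochizukiFrdII2008, Lem 3.2 (ii) p.25] -/
def ItemII_translate : Prop :=
  ∀ A : Set Circle, IsConnected A → IsOpen A → ∃ w : Circle, phi (-1) '' (w • A) = w • A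

/-- **Lemma 3.2 (ii)**, second sentence (FrdII p. 25): "For `n` a positive integer, there exists a
[nonempty] connected open subset `A′ ⊆ A` such that `φ_{-1}(A′) = w · A′`, where `wⁿ = 1`, if and
only if `φ_n(A) ∩ {1, −1} ≠ ∅`." [cite: MochizukiFrdII2008, Lem 3.2 (ii) p.25] -/
def ItemII_roots : Prop :=
  ∀ A : Set Circle, IsConnected A → IsOpen A → ∀ n : ℕ, 0 < n →
    ((∃ A' : Set Circle, IsConnected A' ∧ IsOpen A' ∧ A' ⊆ A ∧
        ∃ w : Circle, w ^ n = 1 ∧ phi (-1) '' A' = w • A') ↔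
      (phi n '' A ∩ {1, -1}).Nonempty)

/-- **Lemma 3.2 (iii)** (FrdII p. 25): "The complement `S¹ \ A` is of cardinality `≤ 1` if and only
if there does not exist an `(A, S¹)`-subset `A′` such that `A′ ≠ A, S¹`."
[cite: MochizukiFrdII2008, Lem 3.2 (iii) p.25] -/
def ItemIII : Prop :=
  ∀ A : Set Circle, IsConnected A → IsOpen A →
    (Aᶜ.Subsingleton ↔ ¬ ∃ A' : Set Circle, IsSub A univ A' ∧ A' ≠ A ∧ A' ≠ univ)

/-- **Lemma 3.2 (iv)** (FrdII p. 25): "Suppose that for some `0 ≠ n ∈ ℤ`, `φ_n(A) ⊆ A`. Then either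
`A = S¹` or `|n| = 1`. Moreover, [in either of these cases] `φ_n(A) = A`" ("angular regions never
shrink", p. 32). [cite: MochizukiFrdII2008, Lem 3.2 (iv) p.25] -/
def ItemIV : Prop :=
  ∀ A : Set Circle, IsConnected A → IsOpen A → ∀ n : ℤ, n ≠ 0 → phi n '' A ⊆ A →
    (A = univ ∨ |n| = 1) ∧ phi n '' A = A

/-- **Lemma 3.2 (v)** (FrdII p. 25): "There exists a finite subset `E ⊆ ℤ` such that for any
`n ∈ ℤ \ E`, and any `(A, S¹)`-subset `A′`, the restriction of `φ_n` to `A′` is surjective, but not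
injective. In particular, for `n ∈ ℤ \ E`, `φ_n(A) = φ_n(B) = S¹`."
[cite: MochizukiFrdII2008, Lem 3.2 (v) p.25] -/
def ItemV : Prop :=
  ∀ A B : Set Circle, Setting A B → ∃ E : Finset ℤ, ∀ n : ℤ, n ∉ E →
    (∀ A' : Set Circle, IsSub A univ A' → SurjOn (phi n) A' univ ∧ ¬ InjOn (phi n) A') ∧
      phi n '' A = univ ∧ phi n '' B = univ

/-- Condition (a) of **Lemma 3.2 (vi)** (FrdII p. 25): any two `(A, B)`-subsets are comparable.
[cite: MochizukiFrdII2008, Lem 3.2 (vi)(a) p.25] -/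
def CondA (A B : Set Circle) : Prop :=
  ∀ A₁ A₂ : Set Circle, IsSub A B A₁ → IsSub A B A₂ → A₁ ⊆ A₂ ∨ A₂ ⊆ A₁

/-- Condition (b) of **Lemma 3.2 (vi)** (FrdII p. 26): between two distinct nested `(A, B)`-subsets
`A₁ ⊊ A₂` there is an `(A₁, A₂)`-subset different from both.
[cite: MochizukiFrdII2008, Lem 3.2 (vi)(b) p.26] -/
def CondB (A B : Set Circle) : Prop :=
  ∀ A₁ A₂ : Set Circle, IsSub A B A₁ → IsSub A B A₂ → A₁ ⊆ A₂ → A₁ ≠ A₂ →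
    ∃ A₃ : Set Circle, IsSub A₁ A₂ A₃ ∧ A₃ ≠ A₁ ∧ A₃ ≠ A₂

/-- Condition (c) of **Lemma 3.2 (vi)** (FrdII p. 26): "The complement `B \ A` is connected"
(possibly empty is excluded by the standing `A ≠ B`; we record preconnectedness of `B \ A`, which
for nonempty sets is Mathlib's connectedness). [cite: MochizukiFrdII2008, Lem 3.2 (vi)(c) p.26] -/
def CondC (A B : Set Circle) : Prop := IsPreconnected (B \ A)

/-- Condition (d) of **Lemma 3.2 (vi)** (FrdII p. 26): "If `B = S¹`, then `B \ A` is of cardinality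
`≤ 1`." [cite: MochizukiFrdII2008, Lem 3.2 (vi)(d) p.26] -/
def CondD (A B : Set Circle) : Prop := B = univ → (B \ A).Subsingleton

/-- Condition (e) of **Lemma 3.2 (vi)** (FrdII p. 26): "`B ≠ S¹`."
[cite: MochizukiFrdII2008, Lem 3.2 (vi)(e) p.26] -/
def CondE (_A B : Set Circle) : Prop := B ≠ univ

/-- **Lemma 3.2 (vi)** (FrdII pp. 25–26): for `A ≠ B`, "(a) holds if and only if both (c) and (d)
hold; both (a) and (b) hold if and only if both (c) and (e) hold."
[cite: MochizukiFrdII2008, Lem 3.2 (vi) pp.25-26] -/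
def ItemVI : Prop :=
  ∀ A B : Set Circle, Setting A B → A ≠ B →
    (CondA A B ↔ CondC A B ∧ CondD A B) ∧ (CondA A B ∧ CondB A B ↔ CondC A B ∧ CondE A B)

/-- **Lemma 3.2 (vi)**, definition (FrdII p. 26): for `A ≠ B` [nonempty connected open, `A ⊆ B`],
"if the pair `(A, B)` satisfies conditions (a) and (b), then we shall say that the pair `(A, B)` is
*continuously ordered*." [cite: MochizukiFrdII2008, Lem 3.2 (vi) p.26] -/
def IsContinuouslyOrdered (A B : Set Circle) : Prop :=
  Setting A B ∧ A ≠ B ∧ CondA A B ∧ CondB A B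

/-- **Lemma 3.2 (vii)** (FrdII p. 26): "Suppose that `A ≠ B`, `B ≠ S¹`. Then there exists an
`(A, B)`-subset `C` such that the pairs `(A, C)`; `(C, B)` are continuously ordered."
[cite: MochizukiFrdII2008, Lem 3.2 (vii) p.26] -/
def ItemVII : Prop :=
  ∀ A B : Set Circle, Setting A B → A ≠ B → B ≠ univ →
    ∃ C : Set Circle, IsSub A B C ∧ IsContinuouslyOrdered A C ∧ IsContinuouslyOrdered C B

/-- **Lemma 3.2 (viii)** (FrdII p. 26): "Suppose that `B \ A` is of cardinality `> 1`. Then there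
exist `(A, B)`-subsets `A₁`, `A₂` such that `B = A₁ ∪ A₂`, `A₁ ≠ S¹`, `A₂ ≠ S¹`."
[cite: MochizukiFrdII2008, Lem 3.2 (viii) p.26] -/
def ItemVIII : Prop :=
  ∀ A B : Set Circle, Setting A B → (B \ A).Nontrivial →
    ∃ A₁ A₂ : Set Circle, IsSub A B A₁ ∧ IsSub A B A₂ ∧ B = A₁ ∪ A₂ ∧ A₁ ≠ univ ∧ A₂ ≠ univ

/-- **Lemma 3.2 (ix)** (FrdII p. 26): "Suppose that `A ≠ B`, and that there does not exist a
connected open subset `D ⊆ B` such that `A ∩ D = ∅`. Then `B = S¹`, and `B \ A` is of cardinality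
`≤ 1`." [cite: MochizukiFrdII2008, Lem 3.2 (ix) p.26] -/
def ItemIX : Prop :=
  ∀ A B : Set Circle, Setting A B → A ≠ B →
    (¬ ∃ D : Set Circle, IsConnected D ∧ IsOpen D ∧ D ⊆ B ∧ A ∩ D = ∅) →
      B = univ ∧ (B \ A).Subsingleton

/-- **Lemma 3.2 (x)** (FrdII p. 26): "If `A ≠ S¹`, then `A` is not homeomorphic to `S¹`."
[cite: MochizukiFrdII2008, Lem 3.2 (x) p.26] -/
def ItemX : Prop :=
  ∀ A : Set Circle, IsConnected A → IsOpen A → A ≠ univ → IsEmpty (A ≃ₜ Circle)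

/-- **Lemma 3.2 (xi)** (FrdII p. 26): "Every automorphism of the topological group `S¹` is equal to
either `φ_1` or `φ_{-1}`." [cite: MochizukiFrdII2008, Lem 3.2 (xi) p.26] -/
def ItemXI : Prop :=
  ∀ f : Circle ≃ₜ* Circle, (∀ z, f z = phi 1 z) ∨ (∀ z, f z = phi (-1) z)

/-- `Homeo(S¹)`: the group of self-homeomorphisms of `S¹` (FrdII Lem. 3.2 (xii), p. 26) — Mathlib's
group structure on `Circle ≃ₜ Circle`. [cite: MochizukiFrdII2008, Lem 3.2 (xii) p.26] -/
abbrev Homeo : Type := Circle ≃ₜ Circle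

/-- The translation `z ↦ w · z` as a self-homeomorphism of `S¹`. [cite: MochizukiFrdII2008, Lem 3.2 (xii) p.26] -/
def translation (w : Circle) : Homeo := Homeomorph.mulLeft w

/-- `Trans(S¹) ⊆ Homeo(S¹)`: "the subgroup [naturally isomorphic to `S¹`] determined by the
translations by elements of `S¹`" (FrdII Lem. 3.2 (xii), p. 26).
[cite: MochizukiFrdII2008, Lem 3.2 (xii) p.26] -/
def trans : Subgroup Homeo where
  carrier := range translation
  mul_mem' := by
    rintro _ _ ⟨v, rfl⟩ ⟨w, rfl⟩
    refine ⟨v * w, Homeomorph.ext fun z => ?_⟩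
    change v * w * z = v * (w * z)
    rw [mul_assoc]
  one_mem' := ⟨1, Homeomorph.ext fun z => by change 1 * z = z; rw [one_mul]⟩
  inv_mem' := by
    rintro _ ⟨w, rfl⟩
    refine ⟨w⁻¹, Homeomorph.ext fun z => ?_⟩
    apply (translation w).injective
    change w * (w⁻¹ * z) = (translation w) ((translation w)⁻¹ z)
    rw [mul_inv_cancel_left]
    exact ((translation w).apply_symm_apply z).symm

/-- `φ_{-1}` (inversion = complex conjugation) as a self-homeomorphism of `S¹`.
[cite: MochizukiFrdII2008, Lem 3.2 (xii) p.26] -/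
def inversion : Homeo := Homeomorph.inv Circle

/-- `Refl(S¹) ⊆ Homeo(S¹)`: "the subgroup generated by `Trans(S¹)`, `φ_{-1}`" (FrdII Lem. 3.2 (xii),
p. 26). [cite: MochizukiFrdII2008, Lem 3.2 (xii) p.26] -/
def refl : Subgroup Homeo := Subgroup.closure ((trans : Set Homeo) ∪ {inversion})

/-- `Trans(S¹) ⊆ Refl(S¹)`. [cite: MochizukiFrdII2008, Lem 3.2 (xii) p.26] -/
theorem trans_le_refl : trans ≤ refl := fun _ hf => Subgroup.subset_closure (Or.inl hf)

/-- `φ_{-1} ∈ Refl(S¹)`. [cite: MochizukiFrdII2008, Lem 3.2 (xii) p.26] -/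
theorem inversion_mem_refl : inversion ∈ refl := Subgroup.subset_closure (Or.inr rfl)

/-- "`Trans(S¹)` [is] naturally isomorphic to `S¹`": `w ↦ (z ↦ w z)` is an injective homomorphism
`S¹ → Homeo(S¹)` with image `Trans(S¹)` (FrdII Lem. 3.2 (xii), p. 26).
[cite: MochizukiFrdII2008, Lem 3.2 (xii) p.26] -/
def translationHom : Circle →* Homeo where
  toFun := translation
  map_one' := Homeomorph.ext fun z => by change 1 * z = z; rw [one_mul]
  map_mul' v w := Homeomorph.ext fun z => by change v * w * z = v * (w * z); rw [mul_assoc]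

/-- `w ↦ (z ↦ w z)` is injective. [cite: MochizukiFrdII2008, Lem 3.2 (xii) p.26] -/
theorem translationHom_injective : Injective translationHom := by
  intro v w h
  have := congrArg (fun f : Homeo => f 1) h
  simpa [translationHom, translation] using this

/-- The image of `w ↦ (z ↦ w z)` is `Trans(S¹)`. [cite: MochizukiFrdII2008, Lem 3.2 (xii) p.26] -/
theorem range_translationHom : translationHom.range = trans := by
  ext f
  simp only [MonoidHom.mem_range]
  rfl

/-- **Lemma 3.2 (xii)**, "`Refl(S¹) ≅ S¹ ⋊ (ℤ/2ℤ)`" (FrdII p. 26), rendered internally: `Trans(S¹)`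
is normal in `Refl(S¹)`, `φ_{-1} ∉ Trans(S¹)`, `φ_{-1}² = 1`, and every element of `Refl(S¹)` is
`τ` or `τ ∘ φ_{-1}` with `τ ∈ Trans(S¹)`. [cite: MochizukiFrdII2008, Lem 3.2 (xii) p.26] -/
def ItemXII_semidirect : Prop :=
  (trans.subgroupOf refl).Normal ∧ inversion ∉ trans ∧ inversion * inversion = 1 ∧
    ∀ f ∈ refl, ∃ τ ∈ trans, f = τ ∨ f = τ * inversion

/-- **Lemma 3.2 (xii)** (FrdII p. 26): "`Trans(S¹) ⊆ Refl(S¹)` is equal to the subgroup of infinitely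
divisible elements" (`f` is infinitely divisible if it has an `n`-th root in `Refl(S¹)` for every
`n ≥ 1`). [cite: MochizukiFrdII2008, Lem 3.2 (xii) p.26] -/
def ItemXII_divisible : Prop :=
  ∀ f : Homeo, f ∈ trans ↔ f ∈ refl ∧ ∀ n : ℕ, 0 < n → ∃ g ∈ refl, g ^ n = f

/-- **Lemma 3.2 (xii)** (FrdII p. 26): "the normalizer in `Homeo(S¹)` of either `Trans(S¹)` or
`Refl(S¹)` is equal to `Refl(S¹)`." [cite: MochizukiFrdII2008, Lem 3.2 (xii) p.26] -/
def ItemXII_normalizer : Prop :=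
  Subgroup.normalizer (trans : Set Homeo) = refl ∧ Subgroup.normalizer (refl : Set Homeo) = refl

/-- **Lemma 3.2 (xii)** (FrdII p. 26): "the centralizer in `Homeo(S¹)` of `Trans(S¹)` is equal to
`Trans(S¹)`." [cite: MochizukiFrdII2008, Lem 3.2 (xii) p.26] -/
def ItemXII_centralizer : Prop := Subgroup.centralizer (trans : Set Homeo) = trans

/-- The elementary half of the centralizer statement: `Trans(S¹)` is commutative, so it centralizes
itself (used on p. 27: "`z = τ_z(1) = τ_z(α(1)) = α(τ_z(1)) = α(z)`" is the other inclusion).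
[cite: MochizukiFrdII2008, Lem 3.2 (xii) pp.26-27] -/
theorem trans_le_centralizer_trans : trans ≤ Subgroup.centralizer (trans : Set Homeo) := by
  rintro _ ⟨v, rfl⟩ _ ⟨w, rfl⟩
  refine Homeomorph.ext fun z => ?_
  simp only [Homeomorph.mul_apply, translation, Homeomorph.coe_mulLeft, mul_left_comm]

end CircleOpens

end

end Literature.AlgebraicGeometry.Frobenioids
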